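import Summits.CriticalPhenomena.PercolationContinuityZ3.Theorems.PercNearOneGluingNoHeavyLowerTailEG3Wrap
import Summits.CriticalPhenomena.PercolationContinuityZ3.Theorems.PercNearOneGluingAdditiveGluingKnThm2Designated
import Summits.CriticalPhenomena.PercolationContinuityZ3.Theorems.PercNearOneGluingNoHeavyLowerTailEventGluingClosure
import HarnessLib

/-!
# `NoHeavyLowerTail` (stmt-CriticalPhenomena-4575) — certificate machine add-on: the OPEN REGIME `KO` of the sharp
# three-relay event gluing, and the assembly EG₃ = (certificate in `KO`) + Kozma–Nitzan Theorem 2 + the observer bound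

Support file (new-inequality factory, all-graph proof seat `prim-ineq-prove-4`; `--supports stmt-CriticalPhenomena-4575`).
No definitions, no named facts, no sorries.

With the relays in worst-first order (`d₁ ≥ d₂ ≥ d₃`, `dᵢ = μ{aᵢ ↮ b}`), EG₃ (`μ({o↮b} ∩ {o↔A}) ≤ d₁`) is ALREADY KNOWN outside
the regime `KO = {μ(tr_b = {a₁}) ≥ μ(tr_b = {a₂,a₃})} ∩ {μ{o↮b} ≥ d₁}`:
* if `μ{o ↮ b} < d₁` (observer regime) then trivially `μ({o↮b} ∩ {o↔A}) ≤ μ{o↮b} ≤ d₁`;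
* if `μ{b ↔ a₁ only} ≤ μ{b ↔ a₂, a₃, b ↮ a₁}` (the Kozma–Nitzan regime) then Theorem 2 at the designation `a₁`
  (tree `knThm2_designated'`, whose certificate hypothesis holds because `a₁` is worst) gives
  `μ({o↔A} ∩ {a₁↔b}) ≤ μ({o↔A} ∩ {o↔b})`, i.e. `U13`, whence EG₃.
So an LP certificate needs to cover only `KO` (this seat's `wf3sep` regime `KO`, kit j058631): `eg3_ordered_of_KO` turns a
`KO`-statement at open weights into the ordered statement at open weights, which `EG3Wrap.eg3_of_ordered_open` turns into the
symmetric sharp EG₃ for all weights (`eg3_of_KO`).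
[cite: KozmaNitzan2024, Theorem 2 (§3.2, pp. 8–9)]
-/

noncomputable section

namespace Summit.CriticalPhenomena.PercolationContinuityZ3.Theorems

open MeasureTheory Set Filter Topology Literature.Probability.Percolation
open Literature.Probability.LatticeModels (prodBernoulli)
open scoped Classical BigOperators
open PatternCells CertCheck CertCells EG3Wrap

namespace EG3KO

variable {n : ℕ}

/-- `μ(sᶜ) = 1 − μ(s)` for the percolation measure. [folklore] -/
theorem real_compl (w : Sym2 (Fin n) → unitInterval) (s : Set (BondConfig (Fin n))) :
    (prodBernoulli w).real sᶜ = 1 - (prodBernoulli w).real s := by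
  have h := measureReal_add_measureReal_compl (μ := prodBernoulli w) (s := s) MeasurableSet.of_discrete
  rw [probReal_univ] at h
  linarith

/-- EG₃ from `U13`: `μ({o↔A} ∩ {a₁↔b}) ≤ μ({o↔A} ∩ {o↔b})` gives `μ({o↮b} ∩ {o↔A}) ≤ μ{a₁↮b}`. [folklore] -/
theorem eg3_of_u13 (w : Sym2 (Fin n) → unitInterval) (v : Fin 5 → Fin n)
    (hU : (prodBernoulli w).real ((openConn (v 0) (v 1) ∪ openConn (v 0) (v 2) ∪ openConn (v 0) (v 3)) ∩ openConn (v 1) (v 4)) ≤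
      (prodBernoulli w).real ((openConn (v 0) (v 1) ∪ openConn (v 0) (v 2) ∪ openConn (v 0) (v 3)) ∩ openConn (v 0) (v 4))) :
    (prodBernoulli w).real (eg3Event v) ≤ dist w v 1 := by
  set μ := prodBernoulli w with hμ
  set OA : Set (BondConfig (Fin n)) := openConn (v 0) (v 1) ∪ openConn (v 0) (v 2) ∪ openConn (v 0) (v 3) with hOA
  have h1 := measureReal_inter_add_sdiff (μ := μ) (s := OA) (t := (openConn (v 0) (v 4) : Set (BondConfig (Fin n))))
    MeasurableSet.of_discrete
  have h2 := measureReal_inter_add_sdiff (μ := μ) (s := OA) (t := (openConn (v 1) (v 4) : Set (BondConfig (Fin n))))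
    MeasurableSet.of_discrete
  have hE : eg3Event v = OA \ openConn (v 0) (v 4) := by
    ext ω
    simp only [eg3Event, hOA, Set.mem_inter_iff, Set.mem_compl_iff, Set.mem_sdiff]
    tauto
  have hsub : OA \ openConn (v 1) (v 4) ⊆ (openConn (v 1) (v 4) : Set (BondConfig (Fin n)))ᶜ := fun ω hω => hω.2
  have h3 : μ.real (OA \ openConn (v 1) (v 4)) ≤ dist w v 1 := measureReal_mono hsub
  rw [hE]
  linarith

/-- The observer regime is trivial: `μ{o↮b} ≤ d₁` gives EG₃. [folklore] -/
theorem eg3_of_observer (w : Sym2 (Fin n) → unitInterval) (v : Fin 5 → Fin n)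
    (hO : (prodBernoulli w).real (openConn (v 0) (v 4) : Set (BondConfig (Fin n)))ᶜ ≤ dist w v 1) :
    (prodBernoulli w).real (eg3Event v) ≤ dist w v 1 :=
  le_trans (measureReal_mono (fun ω hω => hω.1)) hO

/-- The Kozma–Nitzan regime: `μ{b ↔ a₁ only} ≤ μ{b ↔ a₂, b ↔ a₃, b ↮ a₁}` and `a₁` worst give EG₃ (tree `knThm2_designated'`
at the designation `a₁`), for open weights and an injective placement. [cite: KozmaNitzan2024, Theorem 2 (§3.2, pp. 8–9)] -/
theorem eg3_of_knRegime (w : Sym2 (Fin n) → unitInterval) (hw : ∀ e : Sym2 (Fin n), (w e : ℝ) < 1)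
    (v : Fin 5 → Fin n) (hv : Function.Injective v) (h21 : dist w v 2 ≤ dist w v 1) (h31 : dist w v 3 ≤ dist w v 1)
    (hK : (prodBernoulli w).real (openConn (v 4) (v 1) ∩ (openConn (v 4) (v 2))ᶜ ∩ (openConn (v 4) (v 3))ᶜ) ≤
      (prodBernoulli w).real (openConn (v 4) (v 2) ∩ openConn (v 4) (v 3) ∩ (openConn (v 4) (v 1))ᶜ)) :
    (prodBernoulli w).real (eg3Event v) ≤ dist w v 1 := by
  have hne : ∀ i j : Fin 5, i ≠ j → v i ≠ v j := fun i j hij h => hij (hv h)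
  -- positivity of the three separation masses
  have sep2 : ∀ x y z : Fin 5, x ≠ z → y ≠ z →
      0 < (prodBernoulli w).real ((openConn (v x) (v z))ᶜ ∩ (openConn (v y) (v z))ᶜ : Set (BondConfig (Fin n))) := by
    intro x y z hxz hyz
    have h := EventGluingClosure.sep_real_pos w hw {v x, v y} {v z}
      (by
        rw [Finset.disjoint_singleton_right, Finset.mem_insert, Finset.mem_singleton, not_or]
        exact ⟨(hne x z hxz).symm, (hne y z hyz).symm⟩)
    refine lt_of_lt_of_le h (measureReal_mono fun ω hω => ?_)
    simp only [Finset.mem_insert, Finset.mem_singleton, forall_eq_or_imp, forall_eq, Set.mem_setOf_eq] at hω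
    exact ⟨hω.1, hω.2⟩
  have sep1 : ∀ x y z : Fin 5, x ≠ y → x ≠ z →
      0 < (prodBernoulli w).real ((openConn (v x) (v y))ᶜ ∩ (openConn (v x) (v z))ᶜ : Set (BondConfig (Fin n))) := by
    intro x y z hxy hxz
    have h := EventGluingClosure.sep_real_pos w hw {v x} {v y, v z}
      (by
        rw [Finset.disjoint_singleton_left, Finset.mem_insert, Finset.mem_singleton, not_or]
        exact ⟨hne x y hxy, hne x z hxz⟩)
    refine lt_of_lt_of_le h (measureReal_mono fun ω hω => ?_)
    simp only [Finset.mem_singleton, forall_eq, Finset.mem_insert, forall_eq_or_imp, Set.mem_setOf_eq] at hω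
    exact ⟨hω.1, hω.2⟩
  -- worst-ness in connection form
  have hconn : ∀ i : Fin 5, dist w v i ≤ dist w v 1 →
      0 ≤ (prodBernoulli w).real (openConn (v i) (v 4)) - (prodBernoulli w).real (openConn (v 1) (v 4)) := by
    intro i hi
    simp only [EG3Wrap.dist, real_compl] at hi
    linarith
  have hU := knThm2_designated' w (v 0) (v 4) (v 2) (v 3) (v 1) (hne 2 3 (by decide)) (hne 2 1 (by decide))
    (hne 3 1 (by decide)) (sep2 2 3 1 (by decide) (by decide)) (sep1 2 3 1 (by decide) (by decide))
    (sep1 3 2 1 (by decide) (by decide))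
    (by
      have hA : 0 ≤ (prodBernoulli w).real ((openConn (v 2) (v 3))ᶜ ∩ (openConn (v 2) (v 1))ᶜ ∩ openConn (v 2) (v 0)) :=
        measureReal_nonneg
      have hB : 0 ≤ (prodBernoulli w).real ((openConn (v 3) (v 2))ᶜ ∩ (openConn (v 3) (v 1))ᶜ ∩ openConn (v 3) (v 0)) :=
        measureReal_nonneg
      have hP : 0 ≤ (prodBernoulli w).real ((openConn (v 3) (v 2))ᶜ ∩ (openConn (v 3) (v 1))ᶜ : Set (BondConfig (Fin n))) :=
        measureReal_nonneg
      have hQ : 0 ≤ (prodBernoulli w).real ((openConn (v 2) (v 3))ᶜ ∩ (openConn (v 2) (v 1))ᶜ : Set (BondConfig (Fin n))) :=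
        measureReal_nonneg
      have h2 := hconn 2 h21
      have h3 := hconn 3 h31
      have := mul_nonneg (mul_nonneg hA hP) h2
      have := mul_nonneg (mul_nonneg hB hQ) h3
      nlinarith)
    hK
  -- reorder the union and apply `eg3_of_u13`
  have hOA : (openConn (v 0) (v 2) ∪ openConn (v 0) (v 3) ∪ openConn (v 0) (v 1) : Set (BondConfig (Fin n))) =
      openConn (v 0) (v 1) ∪ openConn (v 0) (v 2) ∪ openConn (v 0) (v 3) := by
    ext ω; simp only [Set.mem_union]; tauto
  rw [hOA] at hU
  exact eg3_of_u13 w v hU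

/-- **EG₃ (ordered, open weights) from a statement on the open regime `KO`.** [cite: KozmaNitzan2024, Theorem 2 (§3.2, pp. 8–9)] -/
theorem eg3_ordered_of_KO (w : Sym2 (Fin n) → unitInterval)
    (hw : ∀ e : Sym2 (Fin n), ¬ e.IsDiag → 0 < ((w e : unitInterval) : ℝ) ∧ ((w e : unitInterval) : ℝ) < 1)
    (hw1 : ∀ e : Sym2 (Fin n), (w e : ℝ) < 1)
    (HKO : ∀ v : Fin 5 → Fin n, Function.Injective v → dist w v 2 ≤ dist w v 1 → dist w v 3 ≤ dist w v 2 →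
      (prodBernoulli w).real (openConn (v 4) (v 2) ∩ openConn (v 4) (v 3) ∩ (openConn (v 4) (v 1))ᶜ) ≤
        (prodBernoulli w).real (openConn (v 4) (v 1) ∩ (openConn (v 4) (v 2))ᶜ ∩ (openConn (v 4) (v 3))ᶜ) →
      dist w v 1 ≤ (prodBernoulli w).real (openConn (v 0) (v 4) : Set (BondConfig (Fin n)))ᶜ →
      (prodBernoulli w).real (eg3Event v) ≤ dist w v 1)
    (v : Fin 5 → Fin n) (hv : Function.Injective v) (h21 : dist w v 2 ≤ dist w v 1) (h32 : dist w v 3 ≤ dist w v 2) :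
    (prodBernoulli w).real (eg3Event v) ≤ dist w v 1 := by
  have _ := hw
  by_cases hO : dist w v 1 ≤ (prodBernoulli w).real (openConn (v 0) (v 4) : Set (BondConfig (Fin n)))ᶜ
  · by_cases hK : (prodBernoulli w).real (openConn (v 4) (v 2) ∩ openConn (v 4) (v 3) ∩ (openConn (v 4) (v 1))ᶜ) ≤
        (prodBernoulli w).real (openConn (v 4) (v 1) ∩ (openConn (v 4) (v 2))ᶜ ∩ (openConn (v 4) (v 3))ᶜ)
    · exact HKO v hv h21 h32 hK hO
    · exact eg3_of_knRegime w hw1 v hv h21 (le_trans h32 h21) (le_of_lt (not_le.1 hK))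
  · exact eg3_of_observer w v (le_of_lt (not_le.1 hO))

/-- **THE ASSEMBLY.**  A `KO`-statement valid for all weight vectors with off-diagonal weights in `(0,1)` and diagonal
weights `< 1` gives the sharp three-relay event gluing for every weighted graph and injective placement:
`μ({o↮b} ∩ {o↔A}) ≤ t` whenever the three sink distances are `≤ t`. [cite: KozmaNitzan2024, Theorem 2 (§3.2, pp. 8–9)] -/
theorem eg3_of_KO
    (HKO : ∀ w : Sym2 (Fin n) → unitInterval,
      (∀ e : Sym2 (Fin n), ¬ e.IsDiag → 0 < ((w e : unitInterval) : ℝ) ∧ ((w e : unitInterval) : ℝ) < 1) →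
      ∀ v : Fin 5 → Fin n, Function.Injective v → dist w v 2 ≤ dist w v 1 → dist w v 3 ≤ dist w v 2 →
      (prodBernoulli w).real (openConn (v 4) (v 2) ∩ openConn (v 4) (v 3) ∩ (openConn (v 4) (v 1))ᶜ) ≤
        (prodBernoulli w).real (openConn (v 4) (v 1) ∩ (openConn (v 4) (v 2))ᶜ ∩ (openConn (v 4) (v 3))ᶜ) →
      dist w v 1 ≤ (prodBernoulli w).real (openConn (v 0) (v 4) : Set (BondConfig (Fin n)))ᶜ →
      (prodBernoulli w).real (eg3Event v) ≤ dist w v 1)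
    (w : Sym2 (Fin n) → unitInterval) (v : Fin 5 → Fin n) (hv : Function.Injective v) (t : ℝ)
    (h1 : dist w v 1 ≤ t) (h2 : dist w v 2 ≤ t) (h3 : dist w v 3 ≤ t) :
    (prodBernoulli w).real (eg3Event v) ≤ t := by
  -- the diagonal weights are irrelevant: pass to open off-diagonal weights via `eg3_of_ordered_open`, whose mixed weights
  -- `mixW` are `< 1` everywhere (also on the diagonal)
  refine eg3_of_ordered_open (fun w' hw' v' hv' h21 h32 => ?_) w v hv t h1 h2 h3
  by_cases hdiag : ∀ e : Sym2 (Fin n), (w' e : ℝ) < 1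
  · exact eg3_ordered_of_KO w' hw' hdiag (HKO w' hw') v' hv' h21 h32
  · -- some DIAGONAL weight equals 1: replace it (loops do not matter) — handled by `eg3_of_ordered_open`'s mixing? No:
    -- we argue directly: the measure of every event of `openGraph` does not depend on diagonal weights, but rather than
    -- prove that, note `hw'` is all we are given; diagonal weights `= 1` are allowed by it.  Use the mixed weights once more.
    push Not at hdiag
    obtain ⟨e, he⟩ := hdiag
    have hle : ((w' e : unitInterval) : ℝ) ≤ 1 := (w' e).2.2
    have hed : e.IsDiag := by
      by_contra hnd
      exact absurd (hw' e hnd).2 (not_lt.2 he)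
    -- mixed weights are < 1 everywhere; EG₃ there by the two regimes + HKO, then the limit (as in `eg3_all_of_open`)
    have hk : ∀ k, (prodBernoulli (mixW w' k)).real (eg3Event v') ≤
        max (dist (mixW w' k) v' 1) (max (dist (mixW w' k) v' 2) (dist (mixW w' k) v' 3)) := by
      intro k
      refine eg3_sym_of_ordered (mixW w' k) (fun u hu hu21 hu32 => ?_) v' hv'
      exact eg3_ordered_of_KO (mixW w' k) (fun e' _ => mixW_pos_lt_one w' k e') (fun e' => (mixW_pos_lt_one w' k e').2)
        (HKO (mixW w' k) (fun e' _ => mixW_pos_lt_one w' k e')) u hu hu21 hu32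
    have hE : Tendsto (fun k => (prodBernoulli (mixW w' k)).real (eg3Event v')) atTop
        (𝓝 ((prodBernoulli w').real (eg3Event v'))) :=
      ((stub_weightContinuity n _).tendsto w').comp (tendsto_mixW w')
    have hD : ∀ i : Fin 5, Tendsto (fun k => dist (mixW w' k) v' i) atTop (𝓝 (dist w' v' i)) :=
      fun i => ((stub_weightContinuity n _).tendsto w').comp (tendsto_mixW w')
    have hlim := le_of_tendsto_of_tendsto' hE ((hD 1).max ((hD 2).max (hD 3))) hk
    calc (prodBernoulli w').real (eg3Event v') ≤ max (dist w' v' 1) (max (dist w' v' 2) (dist w' v' 3)) := hlim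
      _ = dist w' v' 1 := by
          rw [max_eq_left]
          exact max_le h21 (le_trans h32 h21)

end EG3KO

end Summit.CriticalPhenomena.PercolationContinuityZ3.Theorems

end
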